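import Literature.Probability.RandomPlanarGeometry.RestrictionMeasuresFiveEighthsInteriorHolds
import Literature.Probability.RandomPlanarGeometry.BrownianExcursionRestriction
import HarnessLib

/-!
# Discharge of `IsRestrictionMeasure.ae_interior_nonempty_of_gt_five_eighths` ([LSW]: for `α > 5/8`, `P_α`-a.e. `K` has an interior point)

Proof-only companion of `RestrictionMeasuresFiveEighths` (no definition, no named fact), after

* G. F. Lawler, O. Schramm, W. Werner, *Conformal restriction: the chordal case*, J. Amer.
  Math. Soc. **16** (2003) 917–955, arXiv:math/0209343 (**[LSW]**, arXiv page numbers): p. 4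
  ("when `5/8 < α`, the measure `P_α` […] is supported on sets with nonempty interior" —
  stated there via Thm. 7.3, p. 29, the Brownian-bubbles construction); §3 Prop. 3.3 (p. 10,
  uniqueness of `P_α`); §4 Prop. 4.1 (p. 16) and the sentence following its proof ("We have
  just proved that the two-sided restriction measure `P_1` exists"); §8.1–8.2 (one-sided
  measures, hung Poisson clouds of excursions).

The named fact `IsRestrictionMeasure.ae_interior_nonempty_of_gt_five_eighths`
(`RestrictionMeasuresFiveEighths`): for every two-sided restriction measure `P` of exponent
`α > 5/8`, `P`-almost every configuration `K` has `(interior K).Nonempty`.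

THE TREE'S PROOF (not the printed one through Thm. 7.3, whose SLE/bubble leaves are still
open, but one assembled entirely from results of [LSW] that ARE in the tree):

1. `P_1` exists — [LSW] §4, Prop. 4.1 (Virág): the filling of the Brownian excursion
   `B = X + i|W⃗|` (`W = (X, W⃗)` a four-dimensional Brownian motion) avoids `A ∈ 𝒬*` with
   probability `Φ'_A(0)`; file `BrownianExcursionRestriction`
   (`exists_isRestrictionMeasure_one_brownianQuad`, 2026-08-15).
2. Positivity `P_α {K | i ∈ interior K} ≠ 0` for EVERY `P_α`, `α > 5/8`, given any `P_1` — the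
   one-sided squeeze of §8: `K ⊇` (left filling) ∩ (right filling), the right boundary of a
   sample of `P_α` dominates a hung excursion cloud `P⁺_{α−5/8}` built from `P_1`, whose
   enclosed open pockets have positive probability of containing `i`; files
   `OneSidedExcursionCloudInterior`, `RestrictionMeasuresFiveEighthsInterior`.
3. The zero–one law for `P_α` (restriction property `P(avoid A ∩ Φ_A⁻¹F) = P(avoid A) P(F)`,
   §3): the `Φ_A`-invariant event `{interior K ≠ ∅}` has probability `0` or `1`; file
   `RestrictionZeroOne`. With 2 it has probability `1`:
   `IsRestrictionMeasure.ae_interior_nonempty_of_gt_five_eighths_of_exists_one`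
   (file `RestrictionMeasuresFiveEighthsInteriorHolds`).

This file only feeds 1 into 3:

* `IsRestrictionMeasure.ae_interior_nonempty_of_gt_five_eighths_holds` — **the discharge**;
* `exists_isRestrictionMeasure_one_ae_interior_nonempty` — the instance most used downstream:
  `P_1` exists AND `P_1`-a.e. `K` has an interior point (cf. `RestrictionMeasuresFiveEighthsCharged`,
  whose hypothesis `∃ P, IsRestrictionMeasure 1 P ∧ P {K | (interior K).Nonempty} ≠ 0` is now met).

## References

* [LSW] p. 4; Prop. 3.3 (p. 10); Prop. 4.1 (p. 16); Thm. 7.3 (p. 29); §8.1–8.2.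
  [LawlerSchrammWerner2003Restriction]
* G. F. Lawler, *Conformally Invariant Processes in the Plane*, AMS (2005), §9.4, Prop. 9.13,
  Cor. 9.11. [Lawler2005]
-/

noncomputable section

open MeasureTheory

namespace Literature.Probability.RandomPlanarGeometry

/-- **[LSW] p. 4 / Thm. 7.3: for `α > 5/8`, `P_α`-almost every configuration has nonempty
interior** — the discharge of the named fact
`IsRestrictionMeasure.ae_interior_nonempty_of_gt_five_eighths`, by the existence of `P_1`
(Prop. 4.1, the Brownian excursion), the one-sided squeeze (§8) and the zero–one law (§3).
[cite: LawlerSchrammWerner2003Restriction, p. 4 and Thm. 7.3 (p. 29); Prop. 4.1 (p. 16); Prop. 3.3 (p. 10); §8.1–8.2] -/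
theorem IsRestrictionMeasure.ae_interior_nonempty_of_gt_five_eighths_holds :
    IsRestrictionMeasure.ae_interior_nonempty_of_gt_five_eighths :=
  IsRestrictionMeasure.ae_interior_nonempty_of_gt_five_eighths_of_exists_one
    exists_isRestrictionMeasure_one_brownianQuad

/-- **`P_1` exists and `P_1`-almost every configuration has an interior point.**
[cite: LawlerSchrammWerner2003Restriction, p. 4; Prop. 4.1 (p. 16)] -/
theorem exists_isRestrictionMeasure_one_ae_interior_nonempty :
    ∃ P : Measure RestrictionConfig, IsRestrictionMeasure 1 P ∧
      ∀ᵐ K : RestrictionConfig ∂P, (interior (K : Set ℂ)).Nonempty := by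
  obtain ⟨P, hP⟩ := exists_isRestrictionMeasure_one_brownianQuad
  exact ⟨P, hP, IsRestrictionMeasure.ae_interior_nonempty_of_gt_five_eighths_holds hP (by norm_num)⟩

end Literature.Probability.RandomPlanarGeometry

end
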